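import Summits.AtomisticToContinuum.Crystallization.Theorems.ChargedEnergyGapCoolGuard
import HarnessLib

/-!
# `ChargedEnergyGap` — the cool guard, SPLIT BENEATH: the GUARDED chart dial
# (cell `decomp-a2c`, lens 3, generation 48, node «CoolGuard», part K-B)

Beneath the translation of part K-A (`chargedEnergyGap_iff_guardedPricing`):
`ChargedEnergyGap ⟺ GrossChargeGapG θ ε s ∧ ChartedChargePricingG θ ε s` (`chargedEnergyGap_iff_piecesG`; record
`(θ, ε, s) = (3/20, 1/10, 1/3)`) — the chart dial of `…ChartDialB.chargedEnergyGap_iff_pieces` with BOTH pieces demanded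
of guarded (cool, `1/3`-separated) periodic configurations only.  EXACT: each guarded piece is implied by the crux through
its unguarded original, and the two guarded pieces glue POINTWISE under the guard to the guarded periodic pricing
(`guardedPricing_of_piecesG`, `κ = κ₁κ₂/(κ₁ + κ₂ + C)`), which part K-A translates back.  Consequently every `∀ Q`-piece
of every later dial may carry the hypothesis `Guard (1/10) (1/3) Q` at no cost (`piecesG_iff_pieces`).  `ChargeRecount`
(= the tree's proved `stub_chargeRecount`) is carried as in part K-A and discharged in part K-A′.

All `[this work]` = cell decomp-a2c lens 3.
-/


noncomputable section

open scoped BigOperators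
open Literature.MathematicalPhysics.StatisticalMechanics
open Literature.Geometry.DiscreteGeometry
open Summit.AtomisticToContinuum.Crystallization.Theses.PricedLinkCensus
open Summit.AtomisticToContinuum.Crystallization.Theorems.ChargedEnergyGapNegative

namespace Summit.AtomisticToContinuum.Crystallization.Theorems.ChargedEnergyGapChartDial

/-! ## The guarded chart dial (beneath part K-A) -/

section GuardedDial

/-- piece · WEAKER(`grossChargeGapG_of_chargedEnergyGap`) · **guarded gross charge gap**: every GUARDED periodic configuration
pays `κ` per gross (uncharted) charged motif site.  Implied by `GrossChargeGap θ`. -/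
def GrossChargeGapG (θ ε s : ℝ) : Prop :=
  ∃ κ : ℝ, 0 < κ ∧ ∀ Q : PeriodicConfiguration 3, Guard ε s Q → κ * (motifChargedGross θ Q : ℝ) ≤ excess Q

/-- piece · WEAKER(`chartedChargePricingG_of_chargedEnergyGap`) · **guarded charted charge pricing**: every GUARDED periodic
configuration pays `κ` per charted charged motif site up to a debit `C` per gross charged site.  Implied by
`ChartedChargePricing θ`. -/
def ChartedChargePricingG (θ ε s : ℝ) : Prop :=
  ∃ κ C : ℝ, 0 < κ ∧ 0 ≤ C ∧ ∀ Q : PeriodicConfiguration 3, Guard ε s Q →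
    κ * (motifChargedCharted θ Q : ℝ) ≤ excess Q + C * (motifChargedGross θ Q : ℝ)

/-- The unguarded gross piece gives the guarded one. -/
theorem grossChargeGapG_of_grossChargeGap {θ : ℝ} (ε s : ℝ) (h : GrossChargeGap θ) : GrossChargeGapG θ ε s := by
  obtain ⟨κ, hκ, h⟩ := h
  exact ⟨κ, hκ, fun Q _ => h Q⟩

/-- The unguarded charted piece gives the guarded one. -/
theorem chartedChargePricingG_of_chartedChargePricing {θ : ℝ} (ε s : ℝ) (h : ChartedChargePricing θ) :
    ChartedChargePricingG θ ε s := by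
  obtain ⟨κ, C, hκ, hC, h⟩ := h
  exact ⟨κ, C, hκ, hC, fun Q _ => h Q⟩

/-- **GUARDED GLUE** (the weighted sum of `periodicPricing_of_pieces`, pointwise under the guard): the two guarded pieces give
the guarded periodic pricing with `κ = κ₁κ₂/(κ₁ + κ₂ + C)`. -/
theorem guardedPricing_of_piecesG {θ ε s : ℝ} (hG : GrossChargeGapG θ ε s) (hP : ChartedChargePricingG θ ε s) :
    ∃ κ : ℝ, 0 < κ ∧ GuardedPricing ε s κ := by
  obtain ⟨κ₁, hκ₁, hG⟩ := hG
  obtain ⟨κ₂, C, hκ₂, hC, hP⟩ := hP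
  have hS : 0 < κ₁ + κ₂ + C := by linarith
  refine ⟨κ₁ * κ₂ / (κ₁ + κ₂ + C), div_pos (mul_pos hκ₁ hκ₂) hS, fun Q hQ => ?_⟩
  have h1 := hG Q hQ
  have h2 := hP Q hQ
  have hsplit : (motifCharged (1 / 100) Q : ℝ) = (motifChargedGross θ Q : ℝ) + (motifChargedCharted θ Q : ℝ) := by
    exact_mod_cast motifCharged_eq_add θ Q
  have hg0 : (0 : ℝ) ≤ motifChargedGross θ Q := Nat.cast_nonneg _
  have hc0 : (0 : ℝ) ≤ motifChargedCharted θ Q := Nat.cast_nonneg _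
  have hX : 0 ≤ excess Q := excess_nonneg' Q
  rw [hsplit, div_mul_eq_mul_div, div_le_iff₀ hS]
  have e1 : κ₁ * κ₂ * (motifChargedGross θ Q : ℝ) ≤ κ₂ * excess Q := by nlinarith
  have e2 : κ₁ * κ₂ * (motifChargedCharted θ Q : ℝ) ≤ κ₁ * excess Q + κ₁ * C * (motifChargedGross θ Q : ℝ) := by nlinarith
  have e3 : κ₁ * C * (motifChargedGross θ Q : ℝ) ≤ C * excess Q := by nlinarith
  nlinarith

/-- **`closes` of the guarded dial**: the two guarded pieces imply the crux (`0 < ε`, `e* + ε ≤ 0`, `s ≤ 1/3`, any `θ`;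
given `ChargeRecount`). -/
theorem chargedEnergyGap_of_piecesG (hF : ChargeRecount) {θ ε s : ℝ} (hε : 0 < ε) (hε0 : eStar + ε ≤ 0)
    (hs : s ≤ 1 / 3) (hG : GrossChargeGapG θ ε s) (hP : ChartedChargePricingG θ ε s) : ChargedEnergyGap :=
  (chargedEnergyGap_iff_guardedPricing hF hε hε0 hs).2 (guardedPricing_of_piecesG hG hP)

/-- WEAKER, guarded gross piece: implied by the crux (through `grossChargeGap_of_chargedEnergyGap`). -/
theorem grossChargeGapG_of_chargedEnergyGap (θ ε s : ℝ) (h : ChargedEnergyGap) : GrossChargeGapG θ ε s :=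
  grossChargeGapG_of_grossChargeGap ε s (grossChargeGap_of_chargedEnergyGap θ h)

/-- WEAKER, guarded charted piece: implied by the crux (through `chartedChargePricing_of_chargedEnergyGap`). -/
theorem chartedChargePricingG_of_chargedEnergyGap (θ ε s : ℝ) (h : ChargedEnergyGap) : ChartedChargePricingG θ ε s :=
  chartedChargePricingG_of_chartedChargePricing ε s (chartedChargePricing_of_chargedEnergyGap θ h)

/-- ★★ **THE GUARDED NODE**: for every chart tolerance `θ`, every `0 < ε` with `e* + ε ≤ 0` and every `s ≤ 1/3`, the crux is
EXACTLY the conjunction of the two GUARDED pieces (given `ChargeRecount`). -/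
theorem chargedEnergyGap_iff_piecesG (hF : ChargeRecount) {θ ε s : ℝ} (hε : 0 < ε) (hε0 : eStar + ε ≤ 0)
    (hs : s ≤ 1 / 3) : ChargedEnergyGap ↔ GrossChargeGapG θ ε s ∧ ChartedChargePricingG θ ε s :=
  ⟨fun h => ⟨grossChargeGapG_of_chargedEnergyGap θ ε s h, chartedChargePricingG_of_chargedEnergyGap θ ε s h⟩,
    fun h => chargedEnergyGap_of_piecesG hF hε hε0 hs h.1 h.2⟩

/-- ★★ **RECORD** `(θ, ε, s) = (3/20, 1/10, 1/3)`: `ChargedEnergyGap ↔ GrossChargeGapG (3/20) (1/10) (1/3) ∧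
ChartedChargePricingG (3/20) (1/10) (1/3)` (given `ChargeRecount`). -/
theorem chargedEnergyGap_iff_piecesG_record (hF : ChargeRecount) :
    ChargedEnergyGap ↔ GrossChargeGapG (3 / 20) (1 / 10) (1 / 3) ∧ ChartedChargePricingG (3 / 20) (1 / 10) (1 / 3) :=
  chargedEnergyGap_iff_piecesG hF (by norm_num) eStar_add_tenth_nonpos le_rfl

/-- The unguarded dial is the `Guard := True` reading: unguarded pieces ⟹ guarded pieces ⟹ crux ⟹ unguarded pieces,
so at admissible `(ε, s)` all four pieces are equivalent to the crux in pairs (`…ChartDialB.chargedEnergyGap_iff_pieces`). -/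
theorem piecesG_iff_pieces (hF : ChargeRecount) {θ ε s : ℝ} (hε : 0 < ε) (hε0 : eStar + ε ≤ 0) (hs : s ≤ 1 / 3) :
    (GrossChargeGapG θ ε s ∧ ChartedChargePricingG θ ε s) ↔ (GrossChargeGap θ ∧ ChartedChargePricing θ) := by
  rw [← chargedEnergyGap_iff_piecesG hF hε hε0 hs]
  exact ⟨fun h => ⟨grossChargeGap_of_chargedEnergyGap θ h, chartedChargePricing_of_chargedEnergyGap θ h⟩,
    fun h => chargedEnergyGap_of_pieces h.1 h.2⟩

end GuardedDial

end Summit.AtomisticToContinuum.Crystallization.Theorems.ChargedEnergyGapChartDial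

end
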